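import Literature.AlgebraicGeometry.Resolution.CentresAndCoordinates

/-!
# Route RisoStrata — crux `RisoGlobalisation` (stmt-ResolutionOfSingularities-18547), leaf `stub_chartMem`

Which standard chart of a projective model with homogeneous coordinates contains a given point.
Let `B` be a projective model of `K/k` (`ProjModel`) with a closed `k`-immersion
`ι_B : B ↪ ℙⁿ_k` and homogeneous coordinates `w ∈ Kⁿ⁺¹ ∖ 0` of its generic point
(`gen_B ≫ ι_B = (w₀ : … : wₙ)`), and let `y ∈ B`.  If `w_γ ≠ 0` and every ratio `w_α / w_γ`
lies in the local ring `𝒪_{B,y} ⊆ K` (`ProjModel.stalkSubring`), then `y` lies in the chart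
`ι_B⁻¹ D₊(x_γ)` (`GeneratingSections.preU ι_B γ`).

Proof (Hartshorne II Thm. 7.1 (a), read inside `K`): `y` lies in SOME chart `ι_B⁻¹ D₊(x_α)`
(the charts cover), hence so does the generic point and `w_α ≠ 0`
(`ne_zero_of_genericPoint_mem_preU`); on that chart the section `ι_B^*(x_γ/x_α)`
(`GeneratingSections.homRatio`) has generic value `w_γ / w_α` (`ofSection_homRatio_eq_div`), whose
inverse `w_α / w_γ` lies in `𝒪_{B,y}` by hypothesis, so its germ at `y` is a unit and
`y ∈ B_{ι^*(x_γ/x_α)} = ι_B⁻¹ D₊(x_α) ∩ ι_B⁻¹ D₊(x_γ)` (`GeneratingSections.basicOpen_homRatio`).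
-/

-- single-problem summit: the doubled namespace component `ResolutionOfSingularities` is forced
set_option linter.dupNamespace false

namespace Summit.ResolutionOfSingularities.ResolutionOfSingularities.Theorems

open AlgebraicGeometry CategoryTheory
open Literature.AlgebraicGeometry.Resolution Literature.AlgebraicGeometry.Motives

attribute [local instance] MvPolynomial.gradedAlgebra

universe u

variable {k K : Type u} [Field k] [Field K] [Algebra k K]

/-- The `K(B)`-point of `ι_B : B ↪ ℙⁿ_k` at the generic point has homogeneous coordinates `w` read
in `K(B) ≅ K`: `Spec K(B) → B → ℙⁿ_k` is `(w₀ : … : wₙ)` transported along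
`B.funFieldAlgEquiv.symm : K ≃ₐ[k] K(B)` (homogeneous coordinates are natural in the field,
`ProjectiveSpace.specMap_comp_pointOfVec_left`). -/
theorem chartMem_fromSpecStalk_genericPoint_comp (B : ProjModel k K) {n : ℕ}
    (ιB : B.X ⟶ Proj (Segre.grading (Fin (n + 1)) k)) (w : Fin (n + 1) → K) (hw : w ≠ 0)
    (hgenB : B.gen ≫ ιB = (ProjectiveSpace.pointOfVec k w hw).left) :
    B.X.fromSpecStalk (genericPoint B.X) ≫ ιB =
      (ProjectiveSpace.pointOfVec k (fun l => B.funFieldAlgEquiv.symm.toAlgHom (w l))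
        (ProjectiveSpace.algHom_comp_ne_zero B.funFieldAlgEquiv.symm.toAlgHom hw)).left := by
  have he : CommRingCat.ofHom (B.funFieldAlgEquiv.symm.toAlgHom : K →+* B.X.functionField) =
      B.funFieldIso.inv := by
    ext b; rfl
  rw [B.fromSpecStalk_genericPoint_eq, Category.assoc, hgenB, ← he]
  exact ProjectiveSpace.specMap_comp_pointOfVec_left B.funFieldAlgEquiv.symm.toAlgHom w hw

/-- `K(B) ≅ K` undoes `K ≃ₐ[k] K(B)`: `funFieldIso.hom (funFieldAlgEquiv.symm x) = x`. -/
theorem chartMem_funFieldIso_hom_symm (B : ProjModel k K) (x : K) :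
    B.funFieldIso.hom.hom (B.funFieldAlgEquiv.symm.toAlgHom x) = x := by
  change B.funFieldIso.hom.hom (B.funFieldAlgEquiv.symm x) = x
  rw [ProjModel.funFieldAlgEquiv_symm_apply, ← CommRingCat.comp_apply, Iso.inv_hom_id,
    CommRingCat.id_apply]

/-- **Which standard chart contains a point**: if all ratios `w_α/w_γ` (with `w_γ ≠ 0`) lie in
the local ring `𝒪_{B,y} ⊆ K`, then `y` lies in the chart `ι_B⁻¹ D₊(x_γ)` (on the chart
`ι_B⁻¹ D₊(x_α) ∋ y` the section `ι^*(x_γ/x_α)` has generic value `w_γ/w_α`, a unit of `𝒪_{B,y}`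
by hypothesis, so `y ∈ B_{ι^*(x_γ/x_α)} = ι⁻¹D₊(x_α) ∩ ι⁻¹D₊(x_γ)`, tree `basicOpen_homRatio`;
Hartshorne II Thm. 7.1 (a)). -/
theorem stub_chartMem (B : ProjModel k K) {n : ℕ}
    (ιB : B.X ⟶ Proj (Segre.grading (Fin (n + 1)) k)) [IsClosedImmersion ιB]
    (_hιB : ιB ≫ Segre.toSpec (Fin (n + 1)) k = B.π) (w : Fin (n + 1) → K) (hw : w ≠ 0)
    (hgenB : B.gen ≫ ιB = (ProjectiveSpace.pointOfVec k w hw).left)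
    (γ : Fin (n + 1)) (hγ : w γ ≠ 0) (y : B.X)
    (hmem : ∀ α, w α * (w γ)⁻¹ ∈ B.stalkSubring y) :
    y ∈ GeneratingSections.preU ιB γ := by
  -- `y` lies in some chart `ι_B⁻¹ D₊(x_α)`, hence so does the generic point
  obtain ⟨α, hyα⟩ : ∃ α, y ∈ GeneratingSections.preU ιB α := by
    have h := (GeneratingSections.iSup_preU ιB).ge (Set.mem_univ y)
    exact TopologicalSpace.Opens.mem_iSup.mp h
  have hη : genericPoint B.X ∈ GeneratingSections.preU ιB α := RatFn.genericPoint_mem_of_mem hyα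
  -- the homogeneous coordinates of the generic point, read in `K(B)`
  set z : Fin (n + 1) → B.X.functionField := fun l => B.funFieldAlgEquiv.symm.toAlgHom (w l)
  have hz : z ≠ 0 := ProjectiveSpace.algHom_comp_ne_zero B.funFieldAlgEquiv.symm.toAlgHom hw
  have hr : B.X.fromSpecStalk (genericPoint B.X) ≫ ιB = (ProjectiveSpace.pointOfVec k z hz).left :=
    chartMem_fromSpecStalk_genericPoint_comp B ιB w hw hgenB
  have hzval : ∀ l, B.funFieldIso.hom.hom (z l) = w l := fun l =>
    chartMem_funFieldIso_hom_symm B (w l)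
  -- `w_α ≠ 0` and `w_γ ≠ 0` in `K(B)`
  have hzα : z α ≠ 0 := ne_zero_of_genericPoint_mem_preU z ιB hz hr hη
  have hzγ : z γ ≠ 0 := fun h0 => hγ (by rw [← hzval γ, h0, map_zero])
  -- the generic value of `ι_B^*(x_γ/x_α)` is `w_γ / w_α`, a unit of `𝒪_{B,y}`
  have hsec : RatFn.ofSection hη (GeneratingSections.homRatio ιB α γ) = z γ / z α :=
    ofSection_homRatio_eq_div z ιB hz hr hη γ
  have hunit : RatFn.IsUnitAt y (RatFn.ofSection hη (GeneratingSections.homRatio ιB α γ)) := by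
    refine RatFn.isUnitAt_iff.mpr ⟨?_, RatFn.isRegularAt_ofSection hyα _, ?_⟩
    · rw [hsec]
      exact div_ne_zero hzγ hzα
    · rw [hsec, inv_div, ProjModel.isRegularAt_iff_mem_stalkSubring, map_div₀, hzval, hzval,
        div_eq_mul_inv]
      exact hmem α
  -- hence `y ∈ B_{ι^*(x_γ/x_α)} = ι⁻¹D₊(x_α) ∩ ι⁻¹D₊(x_γ)`
  have hyb : y ∈ B.X.basicOpen (GeneratingSections.homRatio ιB α γ) :=
    (RatFn.isUnitAt_ofSection_iff hyα _).mp hunit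
  rw [GeneratingSections.basicOpen_homRatio] at hyb
  exact (TopologicalSpace.Opens.mem_inf.mp hyb).2

end Summit.ResolutionOfSingularities.ResolutionOfSingularities.Theorems
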